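import Literature.NumberTheory.Automorphic.ResGLnHermitianConeOpen
import HarnessLib

/-!
# A polynomial gauge on the positive cone — crux HeckeEigenvalueField (stmt-Langlands-13632),
# line Sketch, stub `stub_exists_coneGauge`

On the cone `posCone n K` of self-adjoint matrices over `K_∞ = ℝ^{r₁} × ℂ^{r₂}` positive definite at
every place (`Literature/NumberTheory/Automorphic/ResGLnHermitianCone.lean`) we build a size function
`sz ≥ 1` controlling the entries of `H` and `H⁻¹`, polynomial along segments and under `H ↦ g H gᴴ`,
and polynomial in the entries of `g, g⁻¹` at `H = g gᴴ`.  Elementary, no spectral theory: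
`sz(H) = 1 + E(H) + ∑_w 1 / m(H_w)` (`coneGauge`) with `E(A) = ∑_{i,j} ‖A i j‖` (`entrySum`,
submultiplicative) and, over `ℝ` or `ℂ`, `m(A) = inf_{‖x‖ = 1} re (x⋆ A x)` (`quadMin`, sup norm,
attained on the compact sphere: `m > 0` on positive definite `A`, `re (x⋆ A x) ≥ m(A) ‖x‖²`).  Then
`|A⁻¹ i j| ≤ 1 / m(A)` (the form on the column `A⁻¹ e_j`), `1 / m(aA + bB) ≤ 1 / m(A) + 1 / m(B)`
(`m` is concave) and `m(A) ≤ (1 + E(g⁻¹))² m(g A gᴴ)` (`‖x‖ ≤ E(g⁻¹) ‖gᴴ x‖`); the last property is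
the action bound at `H = g · 1 · gᴴ`.  References: A. Borel, *Introduction aux groupes arithmétiques*
(1969), §12 [Borel1969]; A. Borel, H. Jacquet, Corvallis 1979, §1.2 [BorelJacquetCorvallis1979].
-/

set_option linter.dupNamespace false -- project-wide: `Summit.Langlands.Langlands` is the mandated namespace

noncomputable section

open scoped Classical ComplexOrder Matrix
open Set NumberField NumberField.mixedEmbedding Literature.NumberTheory.Automorphic

namespace Summit.Langlands.Langlands.Theorems.HeckeEigenvalueField.Res

namespace ConeGauge

section Matrix

variable {R : Type*} [NormedRing R] {𝕜 : Type*} [RCLike 𝕜] {m : Type*} [Fintype m]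

/-- The entry sum `E(A) = ∑_{i,j} ‖A i j‖` of a square matrix over a normed ring. [folklore] -/
def entrySum (A : Matrix m m R) : ℝ :=
  ∑ i, ∑ j, ‖A i j‖

/-- `E(A) ≥ 0`. [folklore] -/
theorem entrySum_nonneg (A : Matrix m m R) : 0 ≤ entrySum A :=
  Finset.sum_nonneg fun _ _ => Finset.sum_nonneg fun _ _ => norm_nonneg _

/-- A row sum is at most the entry sum. [folklore] -/
theorem row_le_entrySum (A : Matrix m m R) (i : m) : ∑ j, ‖A i j‖ ≤ entrySum A :=
  Finset.single_le_sum (f := fun i' => ∑ j, ‖A i' j‖)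
    (fun _ _ => Finset.sum_nonneg fun _ _ => norm_nonneg _) (Finset.mem_univ i)

/-- Submultiplicativity of the entry sum. [folklore] -/
theorem entrySum_mul_le (A B : Matrix m m R) : entrySum (A * B) ≤ entrySum A * entrySum B := by
  unfold entrySum
  calc ∑ i, ∑ k, ‖(A * B) i k‖ ≤ ∑ i, ∑ k, ∑ j, ‖A i j‖ * ‖B j k‖ := by
        gcongr with i _ k _
        rw [Matrix.mul_apply]
        exact (norm_sum_le _ _).trans (Finset.sum_le_sum fun j _ => norm_mul_le _ _)
    _ = ∑ i, ∑ j, ‖A i j‖ * ∑ k, ‖B j k‖ := by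
        simp_rw [Finset.mul_sum]
        exact Finset.sum_congr rfl fun _ _ => Finset.sum_comm
    _ ≤ ∑ i, ∑ j, ‖A i j‖ * ∑ j', ∑ k, ‖B j' k‖ := Finset.sum_le_sum fun i _ =>
        Finset.sum_le_sum fun j _ => mul_le_mul_of_nonneg_left (row_le_entrySum B j) (norm_nonneg _)
    _ = (∑ i, ∑ j, ‖A i j‖) * ∑ j', ∑ k, ‖B j' k‖ := by simp_rw [Finset.sum_mul]

/-- The entry sum is invariant under the conjugate transpose. [folklore] -/
theorem entrySum_conjTranspose [StarRing R] [NormedStarGroup R] (A : Matrix m m R) :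
    entrySum Aᴴ = entrySum A := by
  unfold entrySum
  rw [Finset.sum_comm]
  exact Finset.sum_congr rfl fun i _ => Finset.sum_congr rfl fun j _ => norm_star _

/-- The sup norm of `A x` is at most `E(A) ‖x‖`. [folklore] -/
theorem norm_mulVec_le (A : Matrix m m R) (x : m → R) : ‖A *ᵥ x‖ ≤ entrySum A * ‖x‖ := by
  rw [pi_norm_le_iff_of_nonneg (mul_nonneg (entrySum_nonneg A) (norm_nonneg x))]
  intro i
  calc ‖(A *ᵥ x) i‖ ≤ ∑ j, ‖A i j‖ * ‖x‖ := (norm_sum_le _ _).trans (Finset.sum_le_sum fun j _ =>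
        (norm_mul_le _ _).trans (mul_le_mul_of_nonneg_left (norm_le_pi_norm x j) (norm_nonneg _)))
    _ ≤ entrySum A * ‖x‖ := by
        rw [← Finset.sum_mul]
        exact mul_le_mul_of_nonneg_right (row_le_entrySum A i) (norm_nonneg _)

/-- The minimum `m(A) = inf_{‖x‖ = 1} re (x⋆ A x)` of the hermitian form of `A` on the unit sphere of
the sup norm (junk value `0` for an empty index type). [folklore] -/
def quadMin (A : Matrix m m 𝕜) : ℝ :=
  sInf ((fun x : m → 𝕜 => RCLike.re (star x ⬝ᵥ A *ᵥ x)) '' Metric.sphere (0 : m → 𝕜) 1)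

/-- **Scaling**: `m(A) ‖x‖² ≤ re (x⋆ A x)` for every `x` (homogeneity of the form). [folklore] -/
theorem quadMin_mul_norm_sq_le (A : Matrix m m 𝕜) (x : m → 𝕜) :
    quadMin A * ‖x‖ ^ 2 ≤ RCLike.re (star x ⬝ᵥ A *ᵥ x) := by
  by_cases hx : x = 0
  · subst hx
    simp
  · have hn : 0 < ‖x‖ := norm_pos_iff.mpr hx
    have h1 : quadMin A ≤ RCLike.re (star ((‖x‖⁻¹ : 𝕜) • x) ⬝ᵥ A *ᵥ ((‖x‖⁻¹ : 𝕜) • x)) :=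
      csInf_le ((isCompact_sphere (0 : m → 𝕜) 1).image (ResGLnCone.continuous_re_star_dotProduct_mulVec.comp
        (continuous_const.prodMk continuous_id))).bddBelow
        ⟨_, by rw [mem_sphere_zero_iff_norm, norm_smul_inv_norm hx], rfl⟩
    rw [ResGLnCone.re_star_dotProduct_mulVec_smul, norm_inv, RCLike.norm_ofReal, abs_norm] at h1
    calc quadMin A * ‖x‖ ^ 2 ≤ ‖x‖⁻¹ ^ 2 * RCLike.re (star x ⬝ᵥ A *ᵥ x) * ‖x‖ ^ 2 :=
          mul_le_mul_of_nonneg_right h1 (sq_nonneg _)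
      _ = RCLike.re (star x ⬝ᵥ A *ᵥ x) := by field_simp

/-- A lower bound for the form on the (non-empty) unit sphere bounds `m(A)` below. [folklore] -/
theorem le_quadMin [Nonempty m] {A : Matrix m m 𝕜} {c : ℝ}
    (h : ∀ x : m → 𝕜, ‖x‖ = 1 → c ≤ RCLike.re (star x ⬝ᵥ A *ᵥ x)) : c ≤ quadMin A := by
  refine le_csInf ((NormedSpace.sphere_nonempty.mpr zero_le_one).image _) ?_
  rintro _ ⟨x, hx, rfl⟩
  exact h x (mem_sphere_zero_iff_norm.mp hx)

/-- **Positivity**: `m(A) ≥ 0` for `A` positive definite, `> 0` for a non-empty index type (the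
minimum is attained on the compact sphere). [folklore] -/
theorem quadMin_pos {A : Matrix m m 𝕜} (hA : A.PosDef) :
    0 ≤ quadMin A ∧ (Nonempty m → 0 < quadMin A) := by
  have hp : ∀ x ∈ Metric.sphere (0 : m → 𝕜) 1, 0 < RCLike.re (star x ⬝ᵥ A *ᵥ x) := fun x hx =>
    ((ResGLnCone.posDef_iff_isHermitian_and_re_pos A).mp hA).2 x
      (ne_zero_of_mem_unit_sphere ⟨x, hx⟩)
  refine ⟨Real.sInf_nonneg ?_, fun _ => ?_⟩
  · rintro _ ⟨x, hx, rfl⟩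
    exact (hp x hx).le
  · exact ((isCompact_sphere (0 : m → 𝕜) 1).lt_sInf_iff_of_continuous
      (NormedSpace.sphere_nonempty.mpr zero_le_one) (ResGLnCone.continuous_re_star_dotProduct_mulVec.comp
        (continuous_const.prodMk continuous_id)).continuousOn 0).mpr hp

/-- **Segments**: `1 / m(aA + bB) ≤ 1 / m(A) + 1 / m(B)` for positive definite `A, B` (`m` is
concave: `m(aA + bB) ≥ a m(A) + b m(B) ≥ min (m A) (m B)`). [folklore] -/
theorem inv_quadMin_convex_comb_le {A B : Matrix m m 𝕜} (hA : A.PosDef) (hB : B.PosDef)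
    {a b : ℝ} (ha : 0 ≤ a) (hb : 0 ≤ b) (hab : a + b = 1) :
    1 / quadMin (a • A + b • B) ≤ 1 / quadMin A + 1 / quadMin B := by
  cases isEmpty_or_nonempty m
  · rw [Subsingleton.elim (a • A + b • B) A]
    exact le_add_of_nonneg_right (one_div_nonneg.mpr (quadMin_pos hB).1)
  have hqA := (quadMin_pos hA).2 ‹_›
  have hqB := (quadMin_pos hB).2 ‹_›
  have hmin : min (quadMin A) (quadMin B) ≤ quadMin (a • A + b • B) := by
    refine le_quadMin fun x hx => ?_
    have hxA := quadMin_mul_norm_sq_le A x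
    have hxB := quadMin_mul_norm_sq_le B x
    rw [hx, one_pow, mul_one] at hxA hxB
    rw [Matrix.add_mulVec, Matrix.smul_mulVec, Matrix.smul_mulVec, dotProduct_add,
      dotProduct_smul, dotProduct_smul, map_add, RCLike.smul_re, RCLike.smul_re]
    calc min (quadMin A) (quadMin B)
        = a * min (quadMin A) (quadMin B) + b * min (quadMin A) (quadMin B) := by
          rw [← add_mul, hab, one_mul]
      _ ≤ a * RCLike.re (star x ⬝ᵥ A *ᵥ x) + b * RCLike.re (star x ⬝ᵥ B *ᵥ x) :=
          add_le_add (mul_le_mul_of_nonneg_left ((min_le_left _ _).trans hxA) ha)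
            (mul_le_mul_of_nonneg_left ((min_le_right _ _).trans hxB) hb)
  refine (one_div_le_one_div_of_le (lt_min hqA hqB) hmin).trans ?_
  rcases le_total (quadMin A) (quadMin B) with h | h
  · rw [min_eq_left h]
    exact le_add_of_nonneg_right (one_div_nonneg.mpr hqB.le)
  · rw [min_eq_right h]
    exact le_add_of_nonneg_left (one_div_nonneg.mpr hqA.le)

variable [DecidableEq m]

/-- **Entries of the inverse**: `|A⁻¹ i j| ≤ 1 / m(A)` for `A` positive definite (test
`m(A) ‖y‖² ≤ re (y⋆ A y)` on the column `y = A⁻¹ e_j`, where `re (y⋆ A y) = re (y j) ≤ ‖y‖`). [folklore] -/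
theorem norm_inv_apply_le {A : Matrix m m 𝕜} (hA : A.PosDef) (i j : m) :
    ‖A⁻¹ i j‖ ≤ 1 / quadMin A := by
  have hq : 0 < quadMin A := (quadMin_pos hA).2 ⟨i⟩
  set y : m → 𝕜 := A⁻¹ *ᵥ Pi.single j 1 with hy
  have hAy : A *ᵥ y = Pi.single j 1 := by
    rw [hy, Matrix.mulVec_mulVec,
      Matrix.mul_nonsing_inv A ((Matrix.isUnit_iff_isUnit_det A).mp hA.isUnit), Matrix.one_mulVec]
  have h1 : quadMin A * ‖y‖ ^ 2 ≤ ‖y‖ := by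
    calc quadMin A * ‖y‖ ^ 2 ≤ RCLike.re (star y ⬝ᵥ A *ᵥ y) := quadMin_mul_norm_sq_le A y
      _ = RCLike.re (star (y j)) := by rw [hAy, dotProduct_single_one, Pi.star_apply]
      _ ≤ ‖star (y j)‖ := RCLike.re_le_norm _
      _ ≤ ‖y‖ := (norm_star _).trans_le (norm_le_pi_norm y j)
  have h2 : ‖y‖ * quadMin A ≤ 1 := by
    rcases (norm_nonneg y).eq_or_lt with h0 | hpos
    · rw [← h0, zero_mul]
      exact zero_le_one
    · exact le_of_mul_le_mul_right (by nlinarith [h1]) hpos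
  calc ‖A⁻¹ i j‖ = ‖y i‖ := by rw [hy, Matrix.mulVec_single_one, Matrix.col_apply]
    _ ≤ ‖y‖ := norm_le_pi_norm y i
    _ ≤ 1 / quadMin A := (le_div_iff₀ hq).mpr h2

/-- **Action**: `1 / m(g A gᴴ) ≤ (1 + E(g'))² / m(A)` for `A` positive definite and `g g' = 1`
(`re (x⋆ g A gᴴ x) = re ((gᴴx)⋆ A (gᴴx)) ≥ m(A) ‖gᴴ x‖²`, `‖x‖ = ‖g'ᴴ gᴴ x‖ ≤ E(g') ‖gᴴ x‖`). [folklore] -/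
theorem inv_quadMin_conj_le {A : Matrix m m 𝕜} (hA : A.PosDef) (g g' : Matrix m m 𝕜)
    (hg : g * g' = 1) :
    1 / quadMin (g * A * gᴴ) ≤ (1 + entrySum g') ^ 2 * (1 / quadMin A) := by
  have hs : (1 : ℝ) ≤ 1 + entrySum g' := le_add_of_nonneg_right (entrySum_nonneg g')
  cases isEmpty_or_nonempty m
  · rw [Subsingleton.elim (g * A * gᴴ) A]
    exact le_mul_of_one_le_left (one_div_nonneg.mpr (quadMin_pos hA).1) (by nlinarith)
  have hq : 0 < quadMin A := (quadMin_pos hA).2 ‹_›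
  have hm : quadMin A / (1 + entrySum g') ^ 2 ≤ quadMin (g * A * gᴴ) := by
    refine le_quadMin fun x hx => ?_
    have hx' : g'ᴴ *ᵥ (gᴴ *ᵥ x) = x := by
      rw [Matrix.mulVec_mulVec, ← Matrix.conjTranspose_mul, hg, Matrix.conjTranspose_one,
        Matrix.one_mulVec]
    have h1 : 1 ≤ (‖gᴴ *ᵥ x‖ * (1 + entrySum g')) ^ 2 := by
      refine one_le_pow₀ ?_
      calc (1 : ℝ) = ‖g'ᴴ *ᵥ (gᴴ *ᵥ x)‖ := by rw [hx', hx]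
        _ ≤ entrySum g'ᴴ * ‖gᴴ *ᵥ x‖ := norm_mulVec_le _ _
        _ ≤ ‖gᴴ *ᵥ x‖ * (1 + entrySum g') := by
            rw [entrySum_conjTranspose, mul_comm]
            exact mul_le_mul_of_nonneg_left (by linarith) (norm_nonneg _)
    have h2 : RCLike.re (star (gᴴ *ᵥ x) ⬝ᵥ A *ᵥ (gᴴ *ᵥ x)) =
        RCLike.re (star x ⬝ᵥ (g * A * gᴴ) *ᵥ x) := by
      rw [Matrix.star_mulVec, Matrix.conjTranspose_conjTranspose, ← Matrix.dotProduct_mulVec]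
      simp only [Matrix.mulVec_mulVec, Matrix.mul_assoc]
    calc quadMin A / (1 + entrySum g') ^ 2 ≤ quadMin A * ‖gᴴ *ᵥ x‖ ^ 2 := by
          rw [div_le_iff₀ (by positivity), mul_assoc, ← mul_pow]
          exact le_mul_of_one_le_right hq.le h1
      _ ≤ RCLike.re (star (gᴴ *ᵥ x) ⬝ᵥ A *ᵥ (gᴴ *ᵥ x)) := quadMin_mul_norm_sq_le A _
      _ = RCLike.re (star x ⬝ᵥ (g * A * gᴴ) *ᵥ x) := h2
  have hq' : 0 < quadMin (g * A * gᴴ) := lt_of_lt_of_le (by positivity) hm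
  rw [div_le_iff₀ (by positivity)] at hm
  rw [mul_one_div, div_le_div_iff₀ hq' hq, one_mul]
  exact hm.trans_eq (mul_comm _ _)

end Matrix

section Cone

variable {n : ℕ} {K : Type} [Field K] {𝕜 : Type*} [RCLike 𝕜] (φ : mixedSpace K →+* 𝕜)

/-- On the cone `det H` is a unit of `K_∞` (non-zero at every place), so inversion commutes with a
ring homomorphism `φ` of the coefficients (such as the evaluation at a place). [folklore] -/
theorem map_inv_of_mem_posCone {H : ResGLnCone.hermSpace n K} (hH : H ∈ ResGLnCone.posCone n K) :
    (H.1⁻¹).map φ = (H.1.map φ)⁻¹ := by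
  have hdet : IsUnit (Matrix.det H.1) := by
    refine Prod.isUnit_iff.mpr ⟨Pi.isUnit_iff.mpr fun w => ?_, Pi.isUnit_iff.mpr fun w => ?_⟩
    · rw [← mixedSpaceEvalReal_apply, RingHom.map_det]
      exact isUnit_iff_ne_zero.mpr (hH.1 w).det_pos.ne'
    · rw [← mixedSpaceEvalComplex_apply, RingHom.map_det]
      exact isUnit_iff_ne_zero.mpr (hH.2 w).det_pos.ne'
  exact (Matrix.inv_eq_left_inv (by rw [← Matrix.map_mul, Matrix.nonsing_inv_mul _ hdet,
    Matrix.map_one _ (map_zero φ) (map_one φ)])).symm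

/-- **Segments at a place** `φ` (an `ℝ`-linear ring homomorphism, e.g. an evaluation). [folklore] -/
theorem inv_quadMin_map_segment_le (hφ : ∀ (c : ℝ) (a : mixedSpace K), φ (c • a) = c • φ a)
    {H₀ H₁ : ResGLnCone.hermSpace n K} (h₀ : (H₀.1.map φ).PosDef) (h₁ : (H₁.1.map φ).PosDef)
    {t : ℝ} (ht : t ∈ Icc (0 : ℝ) 1) :
    1 / quadMin (((1 - t) • H₀ + t • H₁ : ResGLnCone.hermSpace n K).1.map φ) ≤
      1 / quadMin (H₀.1.map φ) + 1 / quadMin (H₁.1.map φ) := by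
  rw [Submodule.coe_add, Submodule.coe_smul, Submodule.coe_smul, Matrix.map_add _ (map_add φ),
    Matrix.map_smul _ _ (hφ _), Matrix.map_smul _ _ (hφ _)]
  exact inv_quadMin_convex_comb_le h₀ h₁ (sub_nonneg.mpr ht.2) ht.1 (sub_add_cancel 1 t)

variable [NumberField K]

/-- **Action at a place** `φ` (a `*`-preserving, norm-non-increasing ring homomorphism). [folklore] -/
theorem inv_quadMin_map_coneAction_le (hφs : ∀ a : mixedSpace K, φ (star a) = star (φ a))
    (hφn : ∀ a : mixedSpace K, ‖φ a‖ ≤ ‖a‖) (g : GL (Fin n) (mixedSpace K))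
    {H : ResGLnCone.hermSpace n K} (hH : (H.1.map φ).PosDef) :
    1 / quadMin ((ResGLnCone.coneAction n K g H).1.map φ) ≤
      (1 + entrySum g.1 + entrySum (g⁻¹).1) ^ 2 * (1 / quadMin (H.1.map φ)) := by
  rw [ResGLnCone.coe_coneAction, Matrix.map_mul, Matrix.map_mul, Matrix.conjTranspose_map φ hφs]
  have h0 := entrySum_nonneg ((g⁻¹).1.map φ)
  refine (inv_quadMin_conj_le hH _ ((g⁻¹).1.map φ) ?_).trans (mul_le_mul_of_nonneg_right
    (pow_le_pow_left₀ (by positivity) ?_ 2) (one_div_nonneg.mpr (quadMin_pos hH).1))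
  · rw [← Matrix.map_mul, Units.mul_inv, Matrix.map_one _ (map_zero φ) (map_one φ)]
  · have h1 : entrySum ((g⁻¹).1.map φ) ≤ entrySum (g⁻¹).1 :=
      Finset.sum_le_sum fun i _ => Finset.sum_le_sum fun j _ => hφn _
    linarith [entrySum_nonneg g.1]

variable (n K) in
/-- **The cone gauge** `sz(H) = 1 + E(H) + ∑_{w real} 1 / m(H_w) + ∑_{w complex} 1 / m(H_w)` (`H_w` the
evaluation of `H` at the place `w`; only its values on `posCone n K` are used). [folklore] -/
def coneGauge (H : ResGLnCone.hermSpace n K) : ℝ :=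
  1 + entrySum H.1 +
    ((∑ w : {w : InfinitePlace K // w.IsReal}, 1 / quadMin (H.1.map (mixedSpaceEvalReal K w))) +
      ∑ w : {w : InfinitePlace K // w.IsComplex}, 1 / quadMin (H.1.map (mixedSpaceEvalComplex K w)))

/-- On the cone `sz ≥ 1` dominates the entry sum and every place term `1 / m(H_w)`. [folklore] -/
theorem le_coneGauge {H : ResGLnCone.hermSpace n K} (hH : H ∈ ResGLnCone.posCone n K) :
    1 ≤ coneGauge n K H ∧ entrySum H.1 ≤ coneGauge n K H ∧
      (∀ w, 1 / quadMin (H.1.map (mixedSpaceEvalReal K w)) ≤ coneGauge n K H) ∧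
      ∀ w, 1 / quadMin (H.1.map (mixedSpaceEvalComplex K w)) ≤ coneGauge n K H := by
  have hR := fun w => one_div_nonneg.mpr (quadMin_pos (hH.1 w)).1
  have hC := fun w => one_div_nonneg.mpr (quadMin_pos (hH.2 w)).1
  have sR := Finset.sum_nonneg fun w (_ : w ∈ Finset.univ) => hR w
  have sC := Finset.sum_nonneg fun w (_ : w ∈ Finset.univ) => hC w
  have hE := entrySum_nonneg H.1
  unfold coneGauge
  refine ⟨by linarith, by linarith, fun w => ?_, fun w => ?_⟩
  · have h := Finset.single_le_sum (fun w' (_ : w' ∈ Finset.univ) => hR w') (Finset.mem_univ w)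
    linarith
  · have h := Finset.single_le_sum (fun w' (_ : w' ∈ Finset.univ) => hC w') (Finset.mem_univ w)
    linarith

/-- **Entries of `H` and of `H⁻¹`** are bounded by the gauge (sup norm over the places). [folklore] -/
theorem norm_apply_le_coneGauge {H : ResGLnCone.hermSpace n K} (hH : H ∈ ResGLnCone.posCone n K)
    (i j : Fin n) : ‖H.1 i j‖ ≤ coneGauge n K H ∧ ‖H.1⁻¹ i j‖ ≤ coneGauge n K H := by
  obtain ⟨h1, hE, hR, hC⟩ := le_coneGauge hH
  refine ⟨((Finset.single_le_sum (f := fun j' => ‖H.1 i j'‖) (fun _ _ => norm_nonneg _)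
    (Finset.mem_univ j)).trans (row_le_entrySum H.1 i)).trans hE, ?_⟩
  rw [Prod.norm_def, max_le_iff, pi_norm_le_iff_of_nonneg (zero_le_one.trans h1),
    pi_norm_le_iff_of_nonneg (zero_le_one.trans h1)]
  refine ⟨fun w => ?_, fun w => ?_⟩
  · have h : (H.1⁻¹ i j).1 w = (H.1.map (mixedSpaceEvalReal K w))⁻¹ i j := by
      rw [← map_inv_of_mem_posCone _ hH, Matrix.map_apply, mixedSpaceEvalReal_apply]
    exact h ▸ (norm_inv_apply_le (hH.1 w) i j).trans (hR w)
  · have h : (H.1⁻¹ i j).2 w = (H.1.map (mixedSpaceEvalComplex K w))⁻¹ i j := by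
      rw [← map_inv_of_mem_posCone _ hH, Matrix.map_apply, mixedSpaceEvalComplex_apply]
    exact h ▸ (norm_inv_apply_le (hH.2 w) i j).trans (hC w)

/-- **Segments**: `sz((1 - t) H₀ + t H₁) ≤ sz H₀ + sz H₁ ≤ 2 sz(H₀) sz(H₁)` on the cone. [folklore] -/
theorem coneGauge_segment_le {H₀ H₁ : ResGLnCone.hermSpace n K}
    (h₀ : H₀ ∈ ResGLnCone.posCone n K) (h₁ : H₁ ∈ ResGLnCone.posCone n K) {t : ℝ}
    (ht : t ∈ Icc (0 : ℝ) 1) :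
    coneGauge n K ((1 - t) • H₀ + t • H₁) ≤ 2 * (coneGauge n K H₀ * coneGauge n K H₁) ^ 1 := by
  have hE : entrySum ((1 - t) • H₀ + t • H₁ : ResGLnCone.hermSpace n K).1 ≤
      entrySum H₀.1 + entrySum H₁.1 := by
    unfold entrySum
    simp only [← Finset.sum_add_distrib, Submodule.coe_add, Submodule.coe_smul, Matrix.add_apply,
      Matrix.smul_apply]
    refine Finset.sum_le_sum fun i _ => Finset.sum_le_sum fun j _ =>
      (norm_add_le _ _).trans (add_le_add ?_ ?_)
    · rw [_root_.norm_smul, Real.norm_eq_abs, abs_of_nonneg (sub_nonneg.mpr ht.2)]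
      exact mul_le_of_le_one_left (norm_nonneg _) (sub_le_self _ ht.1)
    · rw [_root_.norm_smul, Real.norm_eq_abs, abs_of_nonneg ht.1]
      exact mul_le_of_le_one_left (norm_nonneg _) ht.2
  have hR := Finset.sum_le_sum (s := Finset.univ) fun w _ =>
    inv_quadMin_map_segment_le (mixedSpaceEvalReal K w) (fun _ _ => rfl) (h₀.1 w) (h₁.1 w) ht
  have hC := Finset.sum_le_sum (s := Finset.univ) fun w _ =>
    inv_quadMin_map_segment_le (mixedSpaceEvalComplex K w) (fun _ _ => rfl) (h₀.2 w) (h₁.2 w) ht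
  rw [Finset.sum_add_distrib] at hR hC
  have h5 : coneGauge n K ((1 - t) • H₀ + t • H₁) ≤ coneGauge n K H₀ + coneGauge n K H₁ := by
    unfold coneGauge at *
    linarith
  rw [pow_one]
  nlinarith [(le_coneGauge h₀).1, (le_coneGauge h₁).1]

/-- **Action**: `sz(g H gᴴ) ≤ (1 + E(g) + E(g⁻¹))² sz(H)` on the cone. [folklore] -/
theorem coneGauge_coneAction_le (g : GL (Fin n) (mixedSpace K)) {H : ResGLnCone.hermSpace n K}
    (hH : H ∈ ResGLnCone.posCone n K) :
    coneGauge n K (ResGLnCone.coneAction n K g H) ≤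
      (1 + entrySum g.1 + entrySum (g⁻¹).1) ^ 2 * coneGauge n K H ^ 1 := by
  have hg := entrySum_nonneg g.1
  have hg' := entrySum_nonneg (g⁻¹).1
  have hH0 := entrySum_nonneg H.1
  have hE : entrySum (ResGLnCone.coneAction n K g H).1 ≤
      (1 + entrySum g.1 + entrySum (g⁻¹).1) ^ 2 * entrySum H.1 := by
    have h := (entrySum_mul_le (g.1 * H.1) g.1ᴴ).trans
      (mul_le_mul_of_nonneg_right (entrySum_mul_le g.1 H.1) (entrySum_nonneg _))
    rw [entrySum_conjTranspose, mul_right_comm, ← sq] at h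
    exact h.trans (mul_le_mul_of_nonneg_right (pow_le_pow_left₀ hg (by linarith) 2) hH0)
  have hR := Finset.sum_le_sum (s := Finset.univ) fun w _ =>
    inv_quadMin_map_coneAction_le (mixedSpaceEvalReal K w) (fun _ => rfl)
      (fun a => (norm_le_pi_norm a.1 w).trans (norm_fst_le a)) g (hH.1 w)
  have hC := Finset.sum_le_sum (s := Finset.univ) fun w _ =>
    inv_quadMin_map_coneAction_le (mixedSpaceEvalComplex K w) (fun _ => rfl)
      (fun a => (norm_le_pi_norm a.2 w).trans (norm_snd_le a)) g (hH.2 w)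
  rw [← Finset.mul_sum] at hR hC
  have hS : (1 : ℝ) ≤ (1 + entrySum g.1 + entrySum (g⁻¹).1) ^ 2 := one_le_pow₀ (by linarith)
  rw [pow_one]
  unfold coneGauge at *
  linarith

end Cone

end ConeGauge

open ConeGauge in
/-- **Stub GAUGE — a polynomial gauge on the positive cone.**  A size function `sz ≥ 1` on the cone of
positive hermitian matrices over `K_∞` controlling the entries of `H` and `H⁻¹`, POLYNOMIAL along
segments (`sz(H) = 1 + ∑ ‖H i j‖ + ∑_w 1 / m(H_w)`, `m(M) = min_{‖x‖=1} re x⋆Mx` is concave and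
`|M⁻¹ i j| ≤ 1 / m(M)`), under a fixed `g` (`m(gHgᴴ) ≥ m(H) / (1 + E(g⁻¹))²`) and in the entries of
`g, g⁻¹` at `H = ggᴴ` — the growth scale of the self-regularising primitives.
[cite: BorelJacquetCorvallis1979, §1.2] [folklore] -/
theorem stub_exists_coneGauge (n : ℕ) (K : Type) [Field K] [NumberField K] :
    ∃ sz : ResGLnCone.hermSpace n K → ℝ,
      (∀ H ∈ ResGLnCone.posCone n K, 1 ≤ sz H) ∧
      (∀ H ∈ ResGLnCone.posCone n K, ∀ i j : Fin n,
          ‖(H : Matrix (Fin n) (Fin n) (mixedSpace K)) i j‖ ≤ sz H ∧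
            ‖(H : Matrix (Fin n) (Fin n) (mixedSpace K))⁻¹ i j‖ ≤ sz H) ∧
      (∃ (C : ℝ) (k : ℕ), ∀ H₀ ∈ ResGLnCone.posCone n K, ∀ H₁ ∈ ResGLnCone.posCone n K,
          ∀ t ∈ Set.Icc (0 : ℝ) 1, sz ((1 - t) • H₀ + t • H₁) ≤ C * (sz H₀ * sz H₁) ^ k) ∧
      (∀ g : GL (Fin n) (mixedSpace K), ∃ (C : ℝ) (k : ℕ), ∀ H ∈ ResGLnCone.posCone n K,
          sz (ResGLnCone.coneAction n K g H) ≤ C * sz H ^ k) ∧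
      ∃ (C : ℝ) (k : ℕ), ∀ (g : GL (Fin n) (mixedSpace K)) (H : ResGLnCone.hermSpace n K),
        H ∈ ResGLnCone.posCone n K →
        (H : Matrix (Fin n) (Fin n) (mixedSpace K)) =
            (g : Matrix (Fin n) (Fin n) (mixedSpace K)) * ((g : Matrix (Fin n) (Fin n) (mixedSpace K)))ᴴ →
          sz H ≤ C * (1 + ∑ i : Fin n, ∑ j : Fin n,
            (‖(g : Matrix (Fin n) (Fin n) (mixedSpace K)) i j‖ +
              ‖((g⁻¹ : GL (Fin n) (mixedSpace K)) : Matrix (Fin n) (Fin n) (mixedSpace K)) i j‖)) ^ k := by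
  refine ⟨coneGauge n K, fun H hH => (le_coneGauge hH).1, fun H hH => norm_apply_le_coneGauge hH,
    ⟨2, 1, fun H₀ h₀ H₁ h₁ t => coneGauge_segment_le h₀ h₁⟩,
    fun g => ⟨_, 1, fun H => coneGauge_coneAction_le g⟩,
    ⟨coneGauge n K (ResGLnCone.hermOne n K), 2, fun g H _ hHg => ?_⟩⟩
  have hH : H = ResGLnCone.coneAction n K g (ResGLnCone.hermOne n K) := Subtype.ext (by
    rw [ResGLnCone.coe_coneAction, ResGLnCone.coe_hermOne, Matrix.mul_one]; exact hHg)
  have hs : (1 + ∑ i : Fin n, ∑ j : Fin n,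
      (‖(g : Matrix (Fin n) (Fin n) (mixedSpace K)) i j‖ +
        ‖((g⁻¹ : GL (Fin n) (mixedSpace K)) : Matrix (Fin n) (Fin n) (mixedSpace K)) i j‖)) =
      1 + entrySum g.1 + entrySum (g⁻¹).1 := by
    simp only [entrySum, Finset.sum_add_distrib, add_assoc]
  rw [hH, hs, mul_comm]
  simpa only [pow_one] using coneGauge_coneAction_le g (ResGLnCone.hermOne_mem_posCone n K)

end Summit.Langlands.Langlands.Theorems.HeckeEigenvalueField.Res

end
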